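import Summits.QuantumFields.BalabanUV.T4Continuum.Support.BlockAverageCurrentNearId
import Summits.QuantumFields.BalabanUV.T4Continuum.Support.AveragingDeficitKDatum
import Summits.QuantumFields.BalabanUV.T4Continuum.Support.MinimalActionSandwich
import Literature.MathematicalPhysics.QuantumFieldTheory.Balaban1983to89.B8Ineq129

/-!
# T⁴ programme, node NE3 — candidate row S3-D7 «A-H4-cur», file 2: B11's CURRENT CONDITION (1.9) FOR THE AVERAGED
# COMPETITOR — `rescale L (bavg L U) ∈ ClassSix ε₀ k` from sup-form regularity of `U` at level `k + 1`, k-UNIFORMLY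

NE3 formalisation swarm, leaf seat `b2b-balaban-t4-ne3-formalise-leaf-05` (gen 3); companion of
`Support/BlockAverageCurrentNearId` (file 1, the near-identity-gauge core) and `Support/BlockAverageCurrentAbelian`
(the abelian sanity file).  PURPOSE: the binder `h4` of `MinimalActionRateExists.actionRate_of_exists` read over Bałaban's
class (6) as typed by leaf-04 (`MinimalActionClassSix.ClassSix`) — «the averaged regular configuration of level `k+1` lies in
`ClassSix ε₀ k`» — is DISCHARGED here as pure kinematics of the block average (42), for EVERY `RegularSup d L N b c (k+1) U`
(no minimiser property is used):

§1 gauge bookkeeping: `smallField_gaugeAct`, the FORWARD transported plaquette difference against the covariant flux gradient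
   (`norm_fwdTransDiff_le_of_covGrad`, from leaf-04's `MinimalActionClassSix.norm_transDiff_le_of_covGrad`), and
   `rescale_bavg_gaugeAct` ((45): `rescale L (bavg L U^u) = (rescale L (bavg L U))^{u ∘ (L·)}`);
§2 the LOCAL AXIAL GAUGE (`B8Lemma1NonAbelian.axial_bond_bound_sharp`, root `q − R·𝟙`): a unitary gauge `u` with
   `‖U^u(b) − 1‖ ≤ (d+1)·R·a` on the `l¹`-ball of radius `R` around `q` (`exists_nearId_gauge`);
§3 **`norm_covDiv_rescale_bavg_le`**: unitary `U`, `SmallField U a`, covariant flux gradients `≤ g`,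
   `512(d+1)(d+4)L²a ≤ 1`, `2(d+1)(2dL+8L+8)·a ≤ α`, `(2dL+2L)·α ≤ θ ≤ 1/64` ⇒ for every `η`, bond `(x, μ)`:
   `‖covDiv η (rescale L (bavg L U)) μ x‖ ≤ |η|⁻¹·(d−1)·(L³(2g + αa + 2ρ(4α)) + 520θ²)` — file 1 in the gauge of §2 at the
   coarse corner `L·x`, B8 (1.11) (`B8Ineq132.norm_covDiv_gaugeAct`) and the plane count (`MinimalActionClassSix.norm_covDiv_le`);
§4 the `/(L^k)²` currency: `a = b/(L^{k+1})²`, `g = c/(L^{k+1})³`, `η = (L^k)⁻¹`, regime (Rb) `2¹⁵(d+1)²(d+4)²L²b ≤ 1` ⇒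
   **`norm_covDiv_rescale_bavg_le_scaled`**: `‖covDiv ((L^k)⁻¹) (rescale L (bavg L U)) μ x‖ ≤ 2(d−1)(c + curConst d L·b²)/(L^k)²`
   (the first-order term is the abelian one of the companion file; `curConst` is an explicit polynomial in `d, L`), and
   **`rescale_bavg_mem_classSix`**: `RegularSup d L N b c (k+1) U`, (Rb), `b + 226(8(d+1)(d+4))²b² < ε₀`,
   `2(d−1)(c + curConst d L·b²) < ε₀` ⇒ `rescale L (bavg L U) ∈ ClassSix d L N ε₀ k` — the SAME `ε₀` at every level;
   `classSix_h4` is the literal binder `h4` of `MinimalActionRateExists.actionRate_of_exists` at `𝒞 = ClassSix d L N ε₀`.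

HONEST FRAMING.  Kinematics of (42) on the finite-T⁴ rung (B)+1; OURS ([Balaban1985RegularSpaces] Prop. 3 asserts regularity
transport of this TYPE for minimisers; here it is proved for every sup-regular configuration, constants explicit and crude);
NOTHING about minimisers, T-E, (H∃) or NE3 is asserted; no conditional of the cell (`BetaPertH`, (B), G-an2-4) is used or
hidden; NE3 is NOT proved; spine PROVED 0∕9; NOT infinite volume, NOT a mass gap, NOT Clay, NOT summit progress.
ABSOLUTE RULE kept: no printed sentence is a hypothesis; 2 `def`s (explicit numerical constants `gaugeConst`, `curConst`),
0 `sorry`.  PLACEMENT: `Summits/QuantumFields/BalabanUV/`; imports file 1, `AveragingDeficitKDatum` (gauge covariance of the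
flux gradient), `MinimalActionSandwich` (`IsMinimiser`, for the `h4`-shaped wrapper only) and `B8Ineq129` (for `B8Lemma1NonAbelian` and
`l1_lowPart_le`) BY NAME.
-/

set_option autoImplicit false

open scoped BigOperators Matrix Matrix.Norms.L2Operator
open NormedSpace Finset

namespace Summit.QuantumFields.BalabanUV.T4Continuum.BlockAverageCurrent

open Literature.MathematicalPhysics.QuantumFieldTheory.Balaban1983to89
open B7Prop1Explicit B7Prop2Explicit MatrixLog UnitaryModel
open B7Eq78Linearization (conjR conjR_apply conjR_sub conjR_one)
open B8Ineq132 (plaqF covDiv InAk CondAt plaqF_gaugeAct norm_covDiv_gaugeAct norm_conjR)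
open B8Lemma1NonAbelian (PlaqSmall lowPart lowPart_apply axial_bond_bound_sharp)
open B8Ineq129 (l1_lowPart_le)
open T4AveragingDeficitWall hiding Site Plane Plaq Bond
open T4AveragingDeficitWallBoundary (IsPeriodicCfg)
open T4AveragingDeficitNonAbelian (Ad_mul Ad_sub)
open AveragingDeficitTransport (norm_Ad_of_unitary mem_U1_of_unitary)
open AveragingDeficitKDatum (isUnitaryCfg_gaugeAct norm_covGrad_flux_eq_of_gaugeAct)
open GaugeFieldPerturbation (norm_fhol_sub_one_le_of_smallField)
open MinimalActionRefine (RegularSup)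
open MinimalActionSandwich (IsMinimiser)
open MinimalActionLevels (avgRadius isUnitaryCfg_rescale_bavg isPeriodicCfg_rescale_bavg smallField_rescale_bavg
  norm_Wcx_sub_one_le_quarter)
open MinimalActionRate (avgRadius_level_le)
open MinimalActionClassSix (ClassSix norm_covDiv_le norm_transDiff_le_of_covGrad inAk_univ_of_condAt condAt_top_of_bounds)
open BlockAverageCurrentNearId (norm_transDiff_cplaq_bavg_le)

noncomputable section

variable {d : ℕ} {n : Type*} [Fintype n] [DecidableEq n] [Nonempty n]

/-! ## §1 Gauge bookkeeping -/

/-- The small-field class is gauge invariant under unitary gauge functions: `‖U^u(∂p) − 1‖ = ‖R(u(x))(U(∂p) − 1)‖ = ‖U(∂p) − 1‖`.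
[folklore] -/
theorem smallField_gaugeAct {u : Site d → (Matrix n n ℂ)ˣ} (hu : ∀ z, u z ∈ unitaryUnits (Matrix n n ℂ)) {U : Site d → Fin d → (Matrix n n ℂ)ˣ} {a : ℝ}
    (hS : SmallField U a) : SmallField (gaugeAct u U) a := by
  intro x κ κ' hκ
  have h : ((hol (gaugeAct u U) x (plaqWord κ κ') : (Matrix n n ℂ)ˣ) : (Matrix n n ℂ)) - 1 = conjR (u x) (plaqF U κ κ' x - 1) := by
    rw [conjR_sub, conjR_one, ← plaqF_gaugeAct]; rfl
  rw [h, norm_conjR (mem_U1_of_unitary (hu x))]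
  exact hS x κ κ' hκ

/-- **THE FORWARD TRANSPORTED PLAQUETTE DIFFERENCE AGAINST THE COVARIANT FLUX GRADIENT**: unitary `U`, `SmallField U a`,
`a ≤ 1/4` ⇒ `‖Ad_{U(y,λ)} U(∂p_π(y + e_λ)) − U(∂p_π(y))‖ ≤ 2‖(∇_U F)(y, λ; π)‖` (leaf-04's backward form at `x = y + e_λ`,
transported back by the unitary `U(y, λ)`). [folklore] -/
theorem norm_fwdTransDiff_le_of_covGrad {U : Site d → Fin d → (Matrix n n ℂ)ˣ} (hU : IsUnitaryCfg U) {a : ℝ} (hS : SmallField U a)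
    (ha : a ≤ 1 / 4) (y : Site d) (lam : Fin d) {μ ν : Fin d} (hμν : μ < ν) :
    ‖Ad (U y lam) ((hol U (y + e lam) (plaqWord μ ν) : (Matrix n n ℂ)ˣ) : (Matrix n n ℂ)) - ((hol U y (plaqWord μ ν) : (Matrix n n ℂ)ˣ) : (Matrix n n ℂ))‖
      ≤ 2 * ‖covGrad U (flux U) y lam ⟨(μ, ν), hμν⟩‖ := by
  have h := norm_transDiff_le_of_covGrad hU hS ha (y + e lam) lam ⟨(μ, ν), hμν⟩
  rw [add_sub_cancel_right] at h
  have hu : U y lam ∈ unitaryUnits (Matrix n n ℂ) := hU y lam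
  have e1 : Ad (U y lam) ((hol U (y + e lam) (plaqWord μ ν) : (Matrix n n ℂ)ˣ) : (Matrix n n ℂ)) - ((hol U y (plaqWord μ ν) : (Matrix n n ℂ)ˣ) : (Matrix n n ℂ))
      = Ad (U y lam) (((fhol U (y + e lam, ⟨(μ, ν), hμν⟩) : (Matrix n n ℂ)ˣ) : (Matrix n n ℂ))
          - Ad (U y lam)⁻¹ ((fhol U (y, ⟨(μ, ν), hμν⟩) : (Matrix n n ℂ)ˣ) : (Matrix n n ℂ))) := by
    rw [Ad_sub, ← Ad_mul, mul_inv_cancel]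
    simp [Ad, fhol]
  rw [e1, norm_Ad_of_unitary hu, norm_sub_rev]
  exact h

/-- **(45) after rescaling**: `rescale L (bavg L U^u) = (rescale L (bavg L U))^{u ∘ (L·)}` throughout the small-field class
with `512(d+1)(d+4)L²a ≤ 1` (all loop variables of (42) within `1/4` of `1`), for gauge functions with values in
`{|u| ≤ 1, |u⁻¹| ≤ 1}`. [cite: Balaban1985Averaging, (45) p.24] -/
theorem rescale_bavg_gaugeAct {L : ℕ} (hL : 1 ≤ L) {U : Site d → Fin d → (Matrix n n ℂ)ˣ} (hU : IsUnitaryCfg U) {a : ℝ} (ha : 0 ≤ a)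
    (hsmall : 512 * (d + 1) * (d + 4) * (L : ℝ) ^ 2 * a ≤ 1) (hS : SmallField U a) {u : Site d → (Matrix n n ℂ)ˣ}
    (hu : ∀ z, u z ∈ U1 (Matrix n n ℂ)) :
    rescale L (bavg L (gaugeAct u U)) = gaugeAct (fun z => u ((L : ℤ) • z)) (rescale L (bavg L U)) := by
  funext z κ
  have hW : ∀ r : Fin d → Fin L, ‖((Wcx L U ((L : ℤ) • z) κ (boxVec L r) : (Matrix n n ℂ)ˣ) : (Matrix n n ℂ)) - 1‖ < 1 := fun r =>
    (norm_Wcx_sub_one_le_quarter L hL hU ha hsmall hS _ κ r).trans_lt (by norm_num)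
  simp only [rescale_apply, gaugeAct]
  rw [bavg_gaugeAct L hu U _ κ hW, smul_add]

/-! ## §2 The local axial gauge -/

/-- **A NEAR-IDENTITY GAUGE ON AN `l¹`-BALL**: for unitary `U` with `SmallField U a` and every centre `q` and radius `R`
there is a unitary gauge function `u` (the tree gauge of B8 Lemma 1 rooted at `q − R·𝟙`) with
`‖U^u(y, κ) − 1‖ ≤ (d+1)·R·a` for all bonds with `l¹(y − q) ≤ R`. [cite: Balaban1985Averaging, pp.24–25] -/
theorem exists_nearId_gauge {U : Site d → Fin d → (Matrix n n ℂ)ˣ} (hU : IsUnitaryCfg U) {a : ℝ} (ha : 0 ≤ a) (hS : SmallField U a)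
    (q : Site d) (R : ℕ) :
    ∃ u : Site d → (Matrix n n ℂ)ˣ, (∀ z, u z ∈ unitaryUnits (Matrix n n ℂ)) ∧
      ∀ (y : Site d) (κ : Fin d), l1 (y - q) ≤ R →
        ‖((gaugeAct u U y κ : (Matrix n n ℂ)ˣ) : (Matrix n n ℂ)) - 1‖ ≤ (((d + 1) * R : ℕ) : ℝ) * a := by
  set y₀ : Site d := q - fun _ => (R : ℤ) with hy₀
  refine ⟨axialFn U y₀, fun z => hol_mem_of (S := unitaryUnits (Matrix n n ℂ)) hU _ _, fun y κ hy => ?_⟩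
  have hU1 : ∀ x κ, U x κ ∈ U1 (Matrix n n ℂ) := fun x κ => mem_U1_of_unitary (hU x κ)
  have hP : PlaqSmall U y₀ (y + e κ) a := fun x κ₁ κ₂ hne _ _ => hS x κ₁ κ₂ hne
  have hyx : y₀ ≤ y := by
    intro i
    have h1 : ((y - q) i).natAbs ≤ l1 (y - q) :=
      Finset.single_le_sum (f := fun j => ((y - q) j).natAbs) (fun j _ => Nat.zero_le _) (Finset.mem_univ i)
    have h2 : ((y - q) i).natAbs ≤ R := h1.trans hy
    simp only [Pi.sub_apply] at h2
    show q i - (R : ℤ) ≤ y i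
    omega
  have h := axial_bond_bound_sharp U hU1 hP y₀ y κ le_rfl hyx le_rfl
  refine h.trans (mul_le_mul_of_nonneg_right ?_ ha)
  have h3 : l1 (lowPart κ (y - y₀)) ≤ l1 (y - y₀) := l1_lowPart_le κ _
  have h4 : l1 (y - y₀) ≤ l1 (y - q) + l1 (fun _ : Fin d => (R : ℤ)) := by
    have e1 : y - y₀ = (y - q) + fun _ => (R : ℤ) := by rw [hy₀]; abel
    rw [e1]; exact l1_add_le _ _
  have h5 : l1 (fun _ : Fin d => (R : ℤ)) = d * R := by simp [l1]
  have h6 : l1 (lowPart κ (y - y₀)) ≤ (d + 1) * R := by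
    have := h3.trans (h4.trans (add_le_add hy h5.le)); linarith
  exact_mod_cast h6

/-! ## §3 The current of the averaged configuration -/

/-- **B11 (1.9) FOR THE AVERAGED CONFIGURATION, UNSCALED FORM.**  Unitary `U` with `SmallField U a`,
`512(d+1)(d+4)L²a ≤ 1`, covariant flux gradients `‖(∇_U F)(y,κ;π)‖ ≤ g` at every bond and plane, and constants
`2(d+1)(2dL+8L+8)·a ≤ α`, `(2dL+2L)·α ≤ θ ≤ 1/64` ⇒ for every `η` and every bond `(x, μ)`:
`‖covDiv η (rescale L (bavg L U)) μ x‖ ≤ |η|⁻¹·(d−1)·(L³·(2g + α·a + 2ρ(4α)) + 520·θ²)`, `ρ(t) = e^t − 1 − t`.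
Proof: file 1 (`BlockAverageCurrentNearId.norm_transDiff_cplaq_bavg_le`) in the axial gauge of §2 centred at the coarse corner
`L·x`, gauge covariance (45)+(1.11), and the plane count. [folklore] -/
theorem norm_covDiv_rescale_bavg_le {L : ℕ} (hL : 1 ≤ L) {U : Site d → Fin d → (Matrix n n ℂ)ˣ} (hU : IsUnitaryCfg U)
    {a g α θ : ℝ} (ha : 0 ≤ a) (hsmall : 512 * (d + 1) * (d + 4) * (L : ℝ) ^ 2 * a ≤ 1)
    (hα : 2 * (((d + 1) * (2 * (d * L) + 8 * L + 8) : ℕ) : ℝ) * a ≤ α)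
    (hθ : ((2 * (d * L) + L + L : ℕ) : ℝ) * α ≤ θ) (hθ1 : θ ≤ 1 / 64) (hS : SmallField U a)
    (hG : ∀ (y : Site d) (κ : Fin d) (π : T4AveragingDeficitWall.Plane d), ‖covGrad U (flux U) y κ π‖ ≤ g)
    (η : ℝ) (x : Site d) (μ : Fin d) :
    ‖covDiv η (rescale L (bavg L U)) μ x‖
      ≤ |η|⁻¹ * (((d : ℝ) - 1) * ((L : ℝ) ^ 3 * (2 * g + α * a + 2 * expRem (4 * α)) + 520 * θ ^ 2)) := by
  have hL1 : (1 : ℝ) ≤ L := by exact_mod_cast hL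
  have hK : (4 : ℝ) ≤ 512 * (d + 1) * (d + 4) * (L : ℝ) ^ 2 := by
    have hd0 : (0 : ℝ) ≤ d := Nat.cast_nonneg d
    have hL2 : (1 : ℝ) ≤ (L : ℝ) ^ 2 := one_le_pow₀ hL1
    calc (4 : ℝ) ≤ 512 * 1 * 4 * 1 := by norm_num
      _ ≤ 512 * ((d : ℝ) + 1) * ((d : ℝ) + 4) * (L : ℝ) ^ 2 := by gcongr <;> linarith
  have ha4 : a ≤ 1 / 4 := by nlinarith
  have hα0 : 0 ≤ α := le_trans (by positivity) hα
  -- the gauge around the coarse corner `L·x`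
  obtain ⟨u, hu, hbond⟩ := exists_nearId_gauge hU ha hS ((L : ℤ) • x) (2 * (d * L) + 8 * L + 8)
  have hu1 : ∀ z, u z ∈ U1 (Matrix n n ℂ) := fun z => mem_U1_of_unitary (hu z)
  have hV₀ : IsUnitaryCfg (gaugeAct u U) := isUnitaryCfg_gaugeAct hu hU
  have hS0 : SmallField (gaugeAct u U) a := smallField_gaugeAct hu hS
  have hb : ∀ (y : Site d) (κ : Fin d), l1 (y - (L : ℤ) • x) ≤ 2 * (d * L) + 8 * L + 8 →
      ‖((gaugeAct u U y κ : (Matrix n n ℂ)ˣ) : (Matrix n n ℂ)) - 1‖ ≤ α / 2 := fun y κ hy =>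
    (hbond y κ hy).trans (by linarith)
  -- the flux-Lipschitz datum in gauge-invariant form
  have hΔ : ∀ (μ' ν' : Fin d), μ' < ν' → ∀ (y : Site d) (lam : Fin d),
      ‖Ad (gaugeAct u U y lam) ((hol (gaugeAct u U) (y + e lam) (plaqWord μ' ν') : (Matrix n n ℂ)ˣ) : (Matrix n n ℂ))
          - ((hol (gaugeAct u U) y (plaqWord μ' ν') : (Matrix n n ℂ)ˣ) : (Matrix n n ℂ))‖ ≤ 2 * g := by
    intro μ' ν' h y lam
    have h1 := norm_fwdTransDiff_le_of_covGrad hV₀ hS0 ha4 y lam h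
    have h2 : ‖covGrad (gaugeAct u U) (flux (gaugeAct u U)) y lam ⟨(μ', ν'), h⟩‖ ≤ g := by
      rw [← norm_covGrad_flux_eq_of_gaugeAct hu U y lam ⟨(μ', ν'), h⟩
        ((norm_fhol_sub_one_le_of_smallField hS0 _).trans_lt (by linarith))
        ((norm_fhol_sub_one_le_of_smallField hS0 _).trans_lt (by linarith))]
      exact hG y lam _
    linarith
  -- file 1, for every ordered plane through the bond
  have hF1 : ∀ (μ' ν' : Fin d), μ' < ν' → ∀ lam : Fin d,
      ‖conjR (rescale L (bavg L (gaugeAct u U)) (x - e lam) lam)⁻¹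
            (plaqF (rescale L (bavg L (gaugeAct u U))) μ' ν' (x - e lam))
          - plaqF (rescale L (bavg L (gaugeAct u U))) μ' ν' x‖
        ≤ (L : ℝ) ^ 3 * (2 * g + α * a + 2 * expRem (4 * α)) + 520 * θ ^ 2 := fun μ' ν' h lam =>
    norm_transDiff_cplaq_bavg_le hL hV₀ ((L : ℤ) • x) hα0 hθ hθ1 hb (fun y => hS0 y μ' ν' h.ne) (hΔ μ' ν' h) x rfl lam
  -- gauge covariance (45) + (1.11), then the plane count
  have hu1' : ∀ z, u ((L : ℤ) • z) ∈ U1 (Matrix n n ℂ) := fun z => hu1 _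
  rw [← norm_covDiv_gaugeAct η hu1' (rescale L (bavg L U)) μ x, ← rescale_bavg_gaugeAct hL hU ha hsmall hS hu1]
  exact norm_covDiv_le η _ μ x (fun ν hν => hF1 ν μ hν ν) (fun ν hν => hF1 μ ν hν ν)

/-! ## §4 The `/(L^k)²` currency and the class (6) -/

variable (d) in
/-- The gauge constant `A(d, L) = 2(d+1)(2dL + 8L + 8)`: `‖U^u(b) − 1‖ ≤ (A/2)·a` on the ball of §2 with `R = 2dL + 8L + 8`.
[folklore] -/
def gaugeConst (L : ℕ) : ℝ := 2 * (((d + 1) * (2 * (d * L) + 8 * L + 8) : ℕ) : ℝ)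

variable (d) in
/-- The explicit `b²`-coefficient of the current of the averaged competitor:
`K(d, L) = (A + 32A² + 520((2dL+2L)·A)²)/2`, `A = gaugeConst d L`. [folklore] -/
def curConst (L : ℕ) : ℝ :=
  (gaugeConst d L + 32 * gaugeConst d L ^ 2 + 520 * (((2 * (d * L) + L + L : ℕ) : ℝ) * gaugeConst d L) ^ 2) / 2

omit [Fintype n] [DecidableEq n] [Nonempty n] in
/-- `gaugeConst` is non-negative. [folklore] -/
theorem gaugeConst_nonneg (L : ℕ) : 0 ≤ gaugeConst d L := by unfold gaugeConst; positivity

omit [Fintype n] [DecidableEq n] [Nonempty n] in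
/-- `curConst` is non-negative. [folklore] -/
theorem curConst_nonneg (L : ℕ) : 0 ≤ curConst d L := by
  unfold curConst; have := gaugeConst_nonneg (d := d) L; positivity

omit [Fintype n] [DecidableEq n] [Nonempty n] in
/-- The regime (Rb) `2¹⁵(d+1)²(d+4)²L²·b ≤ 1` dominates the two side conditions of §3 at every level:
`512(d+1)(d+4)L²·(b/(L^{k+1})²) ≤ 1` and `64·(2dL+2L)·A·(b/(L^{k+1})²) ≤ 1`. [folklore] -/
theorem regime_of_Rb {L : ℕ} (hL : 1 ≤ L) {b : ℝ} (hb : 0 ≤ b)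
    (hRb : 2 ^ 15 * ((d : ℝ) + 1) ^ 2 * ((d : ℝ) + 4) ^ 2 * (L : ℝ) ^ 2 * b ≤ 1) (k : ℕ) :
    512 * (d + 1) * (d + 4) * (L : ℝ) ^ 2 * (b / ((L : ℝ) ^ (k + 1)) ^ 2) ≤ 1 ∧
    ((2 * (d * L) + L + L : ℕ) : ℝ) * (gaugeConst d L * (b / ((L : ℝ) ^ (k + 1)) ^ 2)) ≤ 1 / 64 := by
  have hL1 : (1 : ℝ) ≤ L := by exact_mod_cast hL
  have hd0 : (0 : ℝ) ≤ d := Nat.cast_nonneg d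
  have hs1 : (1 : ℝ) ≤ ((L : ℝ) ^ (k + 1)) ^ 2 := one_le_pow₀ (one_le_pow₀ hL1)
  have hab : b / ((L : ℝ) ^ (k + 1)) ^ 2 ≤ b := div_le_self hb hs1
  have ha0 : 0 ≤ b / ((L : ℝ) ^ (k + 1)) ^ 2 := div_nonneg hb (by positivity)
  constructor
  · have hc : 0 ≤ 512 * ((d : ℝ) + 1) * (d + 4) * (L : ℝ) ^ 2 := by positivity
    have h1 : 512 * ((d : ℝ) + 1) * (d + 4) * (L : ℝ) ^ 2 ≤ 2 ^ 15 * ((d : ℝ) + 1) ^ 2 * ((d : ℝ) + 4) ^ 2 * (L : ℝ) ^ 2 := by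
      nlinarith [sq_nonneg ((d : ℝ) + 1), sq_nonneg ((d : ℝ) + 4)]
    calc 512 * ((d : ℝ) + 1) * (d + 4) * (L : ℝ) ^ 2 * (b / ((L : ℝ) ^ (k + 1)) ^ 2)
        ≤ 512 * ((d : ℝ) + 1) * (d + 4) * (L : ℝ) ^ 2 * b := mul_le_mul_of_nonneg_left hab hc
      _ ≤ 2 ^ 15 * ((d : ℝ) + 1) ^ 2 * ((d : ℝ) + 4) ^ 2 * (L : ℝ) ^ 2 * b := mul_le_mul_of_nonneg_right h1 hb
      _ ≤ 1 := hRb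
  · have hc : 0 ≤ ((2 * (d * L) + L + L : ℕ) : ℝ) * gaugeConst d L := by
      have := gaugeConst_nonneg (d := d) L; positivity
    have h1 : 64 * (((2 * (d * L) + L + L : ℕ) : ℝ) * gaugeConst d L)
        ≤ 2 ^ 15 * ((d : ℝ) + 1) ^ 2 * ((d : ℝ) + 4) ^ 2 * (L : ℝ) ^ 2 := by
      unfold gaugeConst; push_cast
      nlinarith [sq_nonneg ((d : ℝ) + 1), sq_nonneg ((d : ℝ) + 4), mul_nonneg hd0 (sub_nonneg.mpr hL1),
        mul_nonneg (mul_nonneg hd0 hd0) (sub_nonneg.mpr hL1), sq_nonneg (L : ℝ), mul_nonneg hd0 hd0]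
    have h2 : ((2 * (d * L) + L + L : ℕ) : ℝ) * (gaugeConst d L * (b / ((L : ℝ) ^ (k + 1)) ^ 2))
        = (((2 * (d * L) + L + L : ℕ) : ℝ) * gaugeConst d L) * (b / ((L : ℝ) ^ (k + 1)) ^ 2) := by ring
    rw [h2]
    calc (((2 * (d * L) + L + L : ℕ) : ℝ) * gaugeConst d L) * (b / ((L : ℝ) ^ (k + 1)) ^ 2)
        ≤ (((2 * (d * L) + L + L : ℕ) : ℝ) * gaugeConst d L) * b := mul_le_mul_of_nonneg_left hab hc
      _ ≤ 1 / 64 := by nlinarith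

omit [Fintype n] [DecidableEq n] [Nonempty n] in
/-- The real arithmetic of the `/(L^k)²` currency: with `t = L^k`, `P = b/(tL)²` the plaquette radius, `c/(tL)³` the flux
gradient, `A·P` the gauge radius and `B·A·P` the `θ` of file 1 (`B = 2dL+2L ≥ 4`, `B·A·P ≤ 1/64`):
`t·(d−1)·(L³(2c/(tL)³ + A·P² + 2ρ(4AP)) + 520(BAP)²) ≤ 2(d−1)(c + K·b²)/t²`, `K = (A + 32A² + 520(BA)²)/2`. [folklore] -/
theorem scaled_arith {t Lr b c A B dm1 : ℝ} (ht : 1 ≤ t) (hLr : 1 ≤ Lr) (hb : 0 ≤ b) (hA : 0 ≤ A)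
    (hB : 4 ≤ B) (hdm1 : 0 ≤ dm1) (hθ1 : B * (A * (b / (t * Lr) ^ 2)) ≤ 1 / 64) :
    t * (dm1 * (Lr ^ 3 * (2 * (c / (t * Lr) ^ 3) + A * (b / (t * Lr) ^ 2) * (b / (t * Lr) ^ 2)
        + 2 * expRem (4 * (A * (b / (t * Lr) ^ 2)))) + 520 * (B * (A * (b / (t * Lr) ^ 2))) ^ 2))
      ≤ 2 * dm1 * (c + (A + 32 * A ^ 2 + 520 * (B * A) ^ 2) / 2 * b ^ 2) / t ^ 2 := by
  have ht0 : 0 < t := by linarith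
  have hL0 : 0 < Lr := by linarith
  set P : ℝ := b / (t * Lr) ^ 2 with hP
  have hP0 : 0 ≤ P := div_nonneg hb (by positivity)
  have hAP : 0 ≤ A * P := mul_nonneg hA hP0
  have h4 : 4 * (A * P) ≤ 1 := by nlinarith
  have hρ : expRem (4 * (A * P)) ≤ 16 * (A * P) ^ 2 :=
    (expRem_le_sq (by positivity) h4).trans_eq (by ring)
  have step1 : t * (dm1 * (Lr ^ 3 * (2 * (c / (t * Lr) ^ 3) + A * P * P + 2 * expRem (4 * (A * P)))
        + 520 * (B * (A * P)) ^ 2))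
      ≤ t * (dm1 * (Lr ^ 3 * (2 * (c / (t * Lr) ^ 3) + A * P * P + 2 * (16 * (A * P) ^ 2))
        + 520 * (B * (A * P)) ^ 2)) := by gcongr
  refine step1.trans ?_
  have e : t * (dm1 * (Lr ^ 3 * (2 * (c / (t * Lr) ^ 3) + A * P * P + 2 * (16 * (A * P) ^ 2))
        + 520 * (B * (A * P)) ^ 2))
      = dm1 * (2 * c / t ^ 2 + (A + 32 * A ^ 2) * (b ^ 2 / (t ^ 3 * Lr))
          + 520 * (B * A) ^ 2 * (b ^ 2 / (t ^ 3 * Lr ^ 4))) := by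
    rw [hP]; field_simp; ring
  have eR : 2 * dm1 * (c + (A + 32 * A ^ 2 + 520 * (B * A) ^ 2) / 2 * b ^ 2) / t ^ 2
      = dm1 * (2 * c / t ^ 2 + (A + 32 * A ^ 2) * (b ^ 2 / t ^ 2) + 520 * (B * A) ^ 2 * (b ^ 2 / t ^ 2)) := by
    field_simp; ring
  have htL : 1 ≤ t * Lr := by nlinarith
  have htL4 : 1 ≤ t * Lr ^ 4 := by
    have : 1 ≤ Lr ^ 4 := one_le_pow₀ hLr
    nlinarith
  have i1 : b ^ 2 / (t ^ 3 * Lr) ≤ b ^ 2 / t ^ 2 :=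
    div_le_div_of_nonneg_left (sq_nonneg b) (by positivity) (by nlinarith [sq_nonneg t])
  have i2 : b ^ 2 / (t ^ 3 * Lr ^ 4) ≤ b ^ 2 / t ^ 2 :=
    div_le_div_of_nonneg_left (sq_nonneg b) (by positivity) (by nlinarith [sq_nonneg t])
  rw [e, eR]
  gcongr

/-- **THE CURRENT OF THE AVERAGED COMPETITOR IN THE TREE'S `/(L^k)²` CURRENCY.**  `L ≥ 1`; unitary `U` with
`SmallField U (b/(L^{k+1})²)` and covariant flux gradients `≤ c/(L^{k+1})³` at every bond and plane (= the `small`∕`grad`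
fields of `RegularSup d L N b c (k+1) U`); regime (Rb) `2¹⁵(d+1)²(d+4)²L²·b ≤ 1` ⇒ for every bond `(x, μ)`:
`‖covDiv ((L^k)⁻¹) (rescale L (bavg L U)) μ x‖ ≤ 2(d−1)·(c + curConst d L·b²)/(L^k)²` — the abelian first-order term
`2(d−1)c/(L^k)²` of the companion file plus an explicit `O(b²)`. [folklore] -/
theorem norm_covDiv_rescale_bavg_le_scaled {L : ℕ} (hL : 1 ≤ L) {U : Site d → Fin d → (Matrix n n ℂ)ˣ}
    (hU : IsUnitaryCfg U) {b c : ℝ} {k : ℕ} (hb : 0 ≤ b)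
    (hRb : 2 ^ 15 * ((d : ℝ) + 1) ^ 2 * ((d : ℝ) + 4) ^ 2 * (L : ℝ) ^ 2 * b ≤ 1)
    (hS : SmallField U (b / ((L : ℝ) ^ (k + 1)) ^ 2))
    (hG : ∀ (y : Site d) (κ : Fin d) (π : T4AveragingDeficitWall.Plane d),
      ‖covGrad U (flux U) y κ π‖ ≤ c / ((L : ℝ) ^ (k + 1)) ^ 3)
    (x : Site d) (μ : Fin d) :
    ‖covDiv (((L : ℝ) ^ k)⁻¹) (rescale L (bavg L U)) μ x‖
      ≤ 2 * ((d : ℝ) - 1) * (c + curConst d L * b ^ 2) / ((L : ℝ) ^ k) ^ 2 := by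
  have hL1 : (1 : ℝ) ≤ L := by exact_mod_cast hL
  have hLk : (1 : ℝ) ≤ (L : ℝ) ^ k := one_le_pow₀ hL1
  have hLk0 : (0 : ℝ) < (L : ℝ) ^ k := by linarith
  have hs : (L : ℝ) ^ (k + 1) = (L : ℝ) ^ k * L := pow_succ _ _
  have ha0 : 0 ≤ b / ((L : ℝ) ^ (k + 1)) ^ 2 := div_nonneg hb (by positivity)
  obtain ⟨hsmall, hθ1⟩ := regime_of_Rb (d := d) hL hb hRb k
  have hA : 2 * (((d + 1) * (2 * (d * L) + 8 * L + 8) : ℕ) : ℝ) * (b / ((L : ℝ) ^ (k + 1)) ^ 2)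
      ≤ gaugeConst d L * (b / ((L : ℝ) ^ (k + 1)) ^ 2) := le_of_eq (by rw [gaugeConst])
  have h := norm_covDiv_rescale_bavg_le hL hU ha0 hsmall hA le_rfl hθ1 hS hG (((L : ℝ) ^ k)⁻¹) x μ
  rw [abs_of_pos (inv_pos.mpr hLk0), inv_inv] at h
  refine h.trans ?_
  have hd : (0 : ℝ) ≤ (d : ℝ) - 1 := by
    have : (1 : ℝ) ≤ d := by exact_mod_cast μ.pos
    linarith
  have hB : (4 : ℝ) ≤ ((2 * (d * L) + L + L : ℕ) : ℝ) := by
    have h1 : 1 ≤ d * L := Nat.le_of_lt_succ (by nlinarith [μ.pos, hL])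
    have : 4 ≤ 2 * (d * L) + L + L := by omega
    exact_mod_cast this
  rw [hs] at hθ1 ⊢
  unfold curConst
  exact scaled_arith hLk hL1 hb (gaugeConst_nonneg (d := d) L) hB hd hθ1

/-- **B11's CLASS (6) RECEIVES THE AVERAGED COMPETITOR, k-UNIFORMLY** (the binder `h4` of
`MinimalActionRateExists.actionRate_of_exists` over `MinimalActionClassSix.ClassSix`, discharged as kinematics):
`RegularSup d L N b c (k+1) U`, regime (Rb) `2¹⁵(d+1)²(d+4)²L²·b ≤ 1`, class threshold `b + 226(8(d+1)(d+4))²b² < ε₀`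
(plaquettes, B7 Prop. 1 (51)) and `2(d−1)(c + curConst d L·b²) < ε₀` (current, §4) ⇒
`rescale L (bavg L U) ∈ ClassSix d L N ε₀ k` — the SAME `ε₀` at every level `k`. [folklore] -/
theorem rescale_bavg_mem_classSix {L N : ℕ} (hL : 1 ≤ L) {b c ε₀ : ℝ} {k : ℕ} (hb : 0 ≤ b)
    (hRb : 2 ^ 15 * ((d : ℝ) + 1) ^ 2 * ((d : ℝ) + 4) ^ 2 * (L : ℝ) ^ 2 * b ≤ 1)
    (hbε : b + 226 * (8 * ((d : ℝ) + 1) * (d + 4)) ^ 2 * b ^ 2 < ε₀)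
    (hcε : 2 * ((d : ℝ) - 1) * (c + curConst d L * b ^ 2) < ε₀)
    {U : Site d → Fin d → (Matrix n n ℂ)ˣ} (hreg : RegularSup d L N b c (k + 1) U) :
    rescale L (bavg L U) ∈ ClassSix d L N ε₀ k := by
  have hL1 : (1 : ℝ) ≤ L := by exact_mod_cast hL
  have hLk0 : (0 : ℝ) < (L : ℝ) ^ k := by positivity
  have ha0 : 0 ≤ b / ((L : ℝ) ^ (k + 1)) ^ 2 := div_nonneg hb (by positivity)
  have hsmall := (regime_of_Rb (d := d) hL hb hRb k).1
  have hε₀ : 0 ≤ ε₀ := by nlinarith [sq_nonneg b]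
  refine ⟨isUnitaryCfg_rescale_bavg L hL hreg.unitary ha0 hsmall hreg.small, ?_,
    inAk_univ_of_condAt hL (inv_pos.mpr hLk0) hε₀ (condAt_top_of_bounds hL (fun x μ ν hμν => ?_) (fun x μ => ?_))⟩
  · refine isPeriodicCfg_rescale_bavg L ?_
    have : ((N * L ^ (k + 1) : ℕ) : ℤ) = (L : ℤ) * ((N * L ^ k : ℕ) : ℤ) := by push_cast; ring
    rw [← this]; exact hreg.periodic
  · have h1 := smallField_rescale_bavg L hL hreg.unitary ha0 hsmall hreg.small x μ ν hμν
    refine (h1.trans (avgRadius_level_le (d := d) L hL b k)).trans_lt ?_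
    exact div_lt_div_of_pos_right hbε (by positivity)
  · refine (norm_covDiv_rescale_bavg_le_scaled hL hreg.unitary hb hRb hreg.small hreg.grad x μ).trans_lt ?_
    exact div_lt_div_of_pos_right hcε (by positivity)

/-- **THE BINDER `h4` OF `MinimalActionRateExists.actionRate_of_exists` AT `𝒞 = ClassSix d L N ε₀`, AS STATED THERE**
(for every datum, level and minimiser — the minimiser property is not used). [folklore] -/
theorem classSix_h4 {L N : ℕ} (hL : 1 ≤ L) {b c ε₀ : ℝ} (hb : 0 ≤ b)
    (hRb : 2 ^ 15 * ((d : ℝ) + 1) ^ 2 * ((d : ℝ) + 4) ^ 2 * (L : ℝ) ^ 2 * b ≤ 1)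
    (hbε : b + 226 * (8 * ((d : ℝ) + 1) * (d + 4)) ^ 2 * b ^ 2 < ε₀)
    (hcε : 2 * ((d : ℝ) - 1) * (c + curConst d L * b ^ 2) < ε₀)
    (dom : Set (Site d → Fin d → (Matrix n n ℂ)ˣ)) :
    ∀ V ∈ dom, ∀ (k : ℕ) (U : Site d → Fin d → (Matrix n n ℂ)ˣ),
      IsMinimiser d (ClassSix (n := n) d L N ε₀) L N (k + 1) V U → RegularSup d L N b c (k + 1) U →
        rescale L (bavg L U) ∈ ClassSix (n := n) d L N ε₀ k :=
  fun _ _ _ _ _ hreg => rescale_bavg_mem_classSix hL hb hRb hbε hcε hreg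

end

end Summit.QuantumFields.BalabanUV.T4Continuum.BlockAverageCurrent
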